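import Summits.RiemannHypothesis.RiemannHypothesis.Theorems.Splittings.LinearRayOnePointDefs

/-!
# The one-point linear-ray check over a WINDOW of `a`-boxes (checker definitions)

Cell rh-split (C15 / S-dbn-1), seat rh-splitx-eng-5 g3.  DEFINITIONS only: the cover version of the
one-point check of `Theorems/Splittings/LinearRayOnePointDefs.lean` — the (expensive, box-independent)
point data `hx ∋ Re H_0(s)`, `hpx ∋ Re H_0′(s)`, forward node values `vF` are computed ONCE, and the cheap
interval-weighted box check `pointCheck` is run for every consecutive box `[As[k], As[k+1]]/AD` of a
breakpoint list `As` (as `UniversalFactor.osaBoxesCheck/osaCoverCheck` do for the medium kernel).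
HONEST LABEL: machinery for refuting an RH-STRENGTHENING conjunct (the linear-factor ray); nothing here
bears on the truth of RH.  Provenance: rh-splitx-eng-5 g3 (cell rh-split, C15 / S-dbn-1 filler → kernel),
monolith `HOME/rh-splitx-eng-5/ray/LinearRayOnePointMono-v3.lean`.
-/

set_option linter.dupNamespace false

namespace Summit.RiemannHypothesis.RiemannHypothesis.Theorems.Splittings.LinearRayOnePoint

open Literature.Analysis.ValidatedNumerics Literature.Analysis.ValidatedNumerics.NumericsMP
open Summit.RiemannHypothesis.RiemannHypothesis.Theorems

/-- Check of the boxes `k < n` at one point with precomputed data: box `k` is `[As[k], As[k+1]]/AD`. [folklore] -/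
def boxesCheck (C : UniversalFactor.OsaCtx) (pt : UniversalFactor.OsaPoint) (hx hpx : MI) (vF : Array MI)
    (As : List ℕ) (AD sc : ℕ) : ℕ → Bool
  | 0 => true
  | k + 1 =>
    boxesCheck C pt hx hpx vF As AD sc k &&
      (decide (As.getD k 0 < As.getD (k + 1) 0) && pointCheck C pt hx hpx vF (As.getD k 0) (As.getD (k + 1) 0) AD sc)

/-- **The window check** with a given evaluator context: context sanity, point sanity, `0 < AD`,
`0 < As[0]`, `2 ≤ As.length`, the point data computed once, and every box passes (scale `2^sc`). [folklore] -/
def linRayCoverCheckWith (oc : Option UniversalFactor.OsaCtx) (pt : UniversalFactor.OsaPoint)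
    (As : List ℕ) (AD sc : ℕ) : Bool :=
  match oc with
  | none => false
  | some C =>
    decide (0 < AD ∧ 0 < As.getD 0 0 ∧ 2 ≤ As.length ∧ 0 < C.rhoUn ∧ 0 < C.rhoUd ∧ 0 < C.RUd ∧
        4 * C.RUn ≤ C.RUd ∧ C.rhoUn * C.RUd < C.RUn * C.rhoUd ∧ 1 ≤ C.Nth ∧ C.phiTab.size = 32 * C.Cu) &&
      pt.ok &&
      match UniversalFactor.osaH0 C pt.xn pt.xd, evalH0D C pt.xn pt.xd,
        UniversalFactor.osaNodeVals C pt false (32 * pt.CyF) 0 #[] with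
      | some hx, some hpx, some vF => boxesCheck C pt hx hpx vF As AD sc (As.length - 1)
      | _, _, _ => false

/-- The window check with the low-window context `mkOsaCtx 256 90 64 20 3 400 1 10 64 6`. [folklore] -/
def linRayCoverCheck (pt : UniversalFactor.OsaPoint) (As : List ℕ) (AD sc : ℕ) : Bool :=
  linRayCoverCheckWith (UniversalFactor.mkOsaCtx 256 90 64 20 3 400 1 10 64 6) pt As AD sc

/-- Anchor of this definitions file: no boxes, nothing to check. [folklore] -/
theorem boxesCheck_zero (C : UniversalFactor.OsaCtx) (pt : UniversalFactor.OsaPoint) (hx hpx : MI) (vF : Array MI)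
    (As : List ℕ) (AD sc : ℕ) : boxesCheck C pt hx hpx vF As AD sc 0 = true := rfl

end Summit.RiemannHypothesis.RiemannHypothesis.Theorems.Splittings.LinearRayOnePoint
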